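import Literature.Probability.Percolation.QuadCrossingSeparatorArm
import Literature.Probability.Percolation.QuadCrossingFreshArms
import HarnessLib

/-!
# The closed arm at the landing point, off a set of revealed edges

Topic `Probability/Percolation`; proofs file towards the named fact `SchrammSmirnov2011_lemma_6_1`
(`QuadCrossingContinuity.lean`; O. Schramm, S. Smirnov, *On the scaling limits of planar
percolation*, Ann. Probab. 39 (2011), arXiv:1101.5820, proof of Lemma 6.1, p. 22: "there is a dual
closed crossing from `∂₃Q` to `(σ₃ ∩ M̄) ∪ ∂₁Q`, in particular crossing the annulus `A(x, δ, d₁/2)`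
inside `[Q] ∖ M`.  The lowest crossing `γ` depends only on the configuration inside `M`, so the
restriction of `ω` to `[Q] ∖ M` is unbiased").

`QuadCrossingSeparatorArm.lean` gives the arm `ω ∈ annulusDualCrossing x δ …`.  For the decoupling
one needs the arm in the form `ω ∪ S ∈ annulusDualCrossing x δ …` — **a closed crossing using no
edge of the revealed set `S`** (`annulusDualCrossingOff`, `QuadCrossingFreshArms.lean`).  This file
proves that version, `Quad.mem_annulusDualCrossingOff_of_not_exists_isCrossing`, under the
hypothesis that matters about `S` (supplied by the freshness theorem of the exploration): **every
point of the segment of a closed edge of `S` inside `[Q]` which is not below `W` is a lattice vertex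
or lies within `r₀` of `x`**.  It also generalises the exit set: `W = L ∪ E` with `E ∋ x` any compact
preconnected subset of `[Q]` meeting `∂₂Q` whose points are joined to `x` inside `B̄(x, ρ) ∩ [Q]`
(for `E = α` a short junction one recovers the original; the exploration uses `E = α ∪` a short
boundary arc).  Argument: the dual path `β` of `Q` (off the open edges AND the vertices) last leaves
the region `M` below `W` through `E`, within `ρ` of `x`; after its last visit to `B̄(x, r₀)`
(`ρ < r₀`) it stays outside `M` (so it meets no closed `S`-segment, by the hypothesis, and no open
one), reaches distance `c₃/2`, and its piece up to the first exit from `B(x, c₃/2)` is shadowed by a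
dual chain of `ω ∪ S` (`mem_annulusDualCrossingOff_of_path`).  Everything is proved.

## References

* O. Schramm, S. Smirnov, Ann. Probab. 39 (2011) 1768–1814, arXiv:1101.5820, proof of Lemma 6.1,
  case (2), eq. (6.2). [SchrammSmirnov2011]
-/

noncomputable section

open scoped unitInterval
open Set Filter Metric Function
open _root_.Topology
open Literature.Probability.LatticeModels

namespace Literature.Probability.Percolation

namespace QuadCrossing

variable {D : Set ℂ}

/-- **Last time below a level.**  For `g` continuous on `[0, 1]` with `g 0 < r` and `r < g 1`, there
is a last time `t₀ ∈ (0, 1)` with `g t₀ ≤ r`; there `g t₀ = r`, and `g > r` afterwards. [folklore] -/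
theorem exists_last_le {g : ℝ → ℝ} (hg : ContinuousOn g (Icc 0 1)) {r : ℝ} (h0 : g 0 < r)
    (h1 : r < g 1) :
    ∃ t₀ ∈ Ioo (0 : ℝ) 1, g t₀ = r ∧ ∀ t ∈ Icc (0 : ℝ) 1, t₀ < t → r < g t := by
  set T : Set ℝ := Icc (0 : ℝ) 1 ∩ g ⁻¹' Iic r with hT
  have hTc : IsClosed T := hg.preimage_isClosed_of_isClosed isClosed_Icc isClosed_Iic
  have hT0 : (0 : ℝ) ∈ T := ⟨⟨le_rfl, zero_le_one⟩, h0.le⟩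
  have hTbdd : BddAbove T := ⟨1, fun t ht => ht.1.2⟩
  set t₀ := sSup T with ht₀
  have ht₀T : t₀ ∈ T := hTc.csSup_mem ⟨0, hT0⟩ hTbdd
  have hg₀ : g t₀ ≤ r := ht₀T.2
  have hafter : ∀ t ∈ Icc (0 : ℝ) 1, t₀ < t → r < g t := fun t ht hlt => by
    by_contra hle
    push Not at hle
    exact absurd (le_csSup hTbdd ⟨ht, hle⟩) (not_le.2 hlt)
  have ht₀1 : t₀ < 1 := by
    rcases ht₀T.1.2.eq_or_lt with h | h
    · exfalso; rw [h] at hg₀; linarith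
    · exact h
  have heq : g t₀ = r := by
    rcases hg₀.eq_or_lt with h | h
    · exact h
    · exfalso
      -- intermediate value on `[t₀, 1]`
      obtain ⟨s, hs, hse⟩ := intermediate_value_Icc ht₀1.le (hg.mono (Icc_subset_Icc ht₀T.1.1 le_rfl))
        (show r ∈ Icc (g t₀) (g 1) from ⟨h.le, h1.le⟩)
      have hsT : s ∈ T := ⟨⟨ht₀T.1.1.trans hs.1, hs.2⟩, hse.le⟩
      have hst : s ≤ t₀ := le_csSup hTbdd hsT
      have : s = t₀ := le_antisymm hst hs.1
      rw [this] at hse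
      linarith
  have ht₀0 : 0 < t₀ := by
    rcases ht₀T.1.1.eq_or_lt with h | h
    · exfalso; rw [← h] at heq; linarith
    · exact h
  exact ⟨t₀, ⟨ht₀0, ht₀1⟩, heq, hafter⟩

namespace Quad

variable {Q : Quad D} {δ : ℝ} {ω : BondConfig (Site 2)}

/-- **The closed arm at the landing point, using no edge of `S`.**  Let `L ⊆ [Q] ∩ openEdgeUnion δ ω`
(`δ > 0`) be compact, connected and meet `∂₀Q`; `x ∈ L` with all junctions to `∂₃Q` of diameter
`≥ c₃`; `E ∋ x` a compact preconnected subset of `[Q]` meeting `∂₂Q`, each of whose points is joined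
to `x` by a path of `[Q]` staying within `ρ` of `x`; `W = L ∪ E` and `M` the region of `[Q]` below
`W`.  Let `S` be a set of edges such that every point of the segment of a closed edge of `S` inside
`[Q] ∖ M` is a lattice vertex or within distance `< r₀` of `x`, where `ρ < r₀` and `r₀ + 2δ ≤ c₃/2`.
If `Q` has no crossing inside the open edges, then `ω ∪ S ∈ annulusDualCrossing x δ (r₀ + 2δ)
(c₃/2 - 2δ)`, i.e. `ω ∈ annulusDualCrossingOff S x δ (r₀ + 2δ) (c₃/2 - 2δ)`.
[cite: SchrammSmirnov2011, proof of Lemma 6.1, case (2), eq. (6.2)] -/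
theorem mem_annulusDualCrossingOff_of_not_exists_isCrossing (hδ : 0 < δ) {L : Set ℂ}
    (hLc : IsCompact L) (hLconn : IsConnected L) (hLQ : L ⊆ Q.carrier)
    (hLO : L ⊆ openEdgeUnion δ ω) (hL0 : (L ∩ Q.side 0).Nonempty) {x : ℂ} (hxL : x ∈ L) {c₃ : ℝ}
    (hfar : ∀ t ∈ Q.side 3, ∀ p : Path x t, range p ⊆ Q.carrier → c₃ ≤ Metric.diam (range p))
    {ρ : ℝ} (hρ : 0 ≤ ρ) {E : Set ℂ} (hEc : IsCompact E) (hEpc : IsPreconnected E)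
    (hEQ : E ⊆ Q.carrier) (hxE : x ∈ E) (hE2 : (E ∩ Q.side 2).Nonempty)
    (hEjoin : ∀ e ∈ E, ∃ p : Path x e, range p ⊆ Q.carrier ∧ ∀ s, dist (p s) x ≤ ρ)
    {r₀ : ℝ} (hρr : ρ < r₀) (hr₀c : r₀ + 2 * δ ≤ c₃ / 2) {S : Set (Sym2 (Site 2))}
    (hS : ∀ a b : Site 2, (zdGraph 2).Adj a b → s(a, b) ∈ S → s(a, b) ∉ ω →
      ∀ q ∈ segment ℝ (meshPoint δ a) (meshPoint δ b), q ∈ Q.carrier →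
        q ∉ {z | z ∈ Q.carrier ∧ ∀ t ∈ Q.side 3, ∀ p : Path z t,
          range p ⊆ Q.carrier → (range p ∩ (L ∪ E)).Nonempty} →
        q ∈ range (meshPoint δ) ∨ dist q x < r₀)
    (hnot : ¬ ∃ K, Q.IsCrossing K ∧ K ⊆ openEdgeUnion δ ω) :
    ω ∈ annulusDualCrossingOff S x δ (r₀ + 2 * δ) (c₃ / 2 - 2 * δ) := by
  have hr₀c₃ : r₀ < c₃ / 2 := by linarith
  have hρc₃ : ρ < c₃ / 2 := by linarith
  -- points of `E` are within `ρ` of `x`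
  have hEx : ∀ e ∈ E, dist e x ≤ ρ := fun e he => by
    obtain ⟨p, -, hp⟩ := hEjoin e he
    simpa [p.target] using hp 1
  -- the dual path of `Q` (off the open edges and the vertices)
  obtain ⟨β, hβc, hβQ, hβ0, hβ1, hβO⟩ := Q.exists_path_avoiding_of_not_exists_isCrossing hδ hnot
  -- the set `W = L ∪ E` and the region below it
  set W : Set ℂ := L ∪ E with hW
  have hWc : IsCompact W := hLc.union hEc
  have hWconn : IsConnected W := by
    refine ⟨⟨x, Or.inl hxL⟩, ?_⟩
    rw [hW, show L ∪ E = ⋃₀ {L, E} by simp]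
    exact isPreconnected_sUnion x {L, E} (by rintro s (rfl | rfl); exacts [hxL, hxE])
      (by rintro s (rfl | rfl); exacts [hLconn.isPreconnected, hEpc])
  have hWQ : W ⊆ Q.carrier := union_subset hLQ hEQ
  have hW0 : (W ∩ Q.side 0).Nonempty := hL0.mono (inter_subset_inter_left _ subset_union_left)
  have hW2 : (W ∩ Q.side 2).Nonempty := hE2.mono (inter_subset_inter_left _ subset_union_right)
  set M : Set ℂ := {z | z ∈ Q.carrier ∧ ∀ t ∈ Q.side 3, ∀ p : Path z t,
      range p ⊆ Q.carrier → (range p ∩ W).Nonempty} with hM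
  -- no point of `∂₃Q` is in `E`
  have hE3 : ∀ e ∈ E, e ∉ Q.side 3 := by
    intro e he he3
    obtain ⟨p, hpQ, hp⟩ := hEjoin e he
    have := hfar e he3 p hpQ
    have hle : Metric.diam (range p) ≤ 2 * ρ := by
      refine Metric.diam_le_of_forall_dist_le (by positivity) ?_
      rintro _ ⟨s, rfl⟩ _ ⟨s', rfl⟩
      linarith [dist_triangle (p s) x (p s'), dist_comm x (p s'), hp s, hp s']
    linarith
  -- `β 0` is below `W`, `β 1` is not
  have hβ0M : β 0 ∈ M := Quad.side_one_subset_below hWc hWconn.isPreconnected hWQ hW0 hW2 hβ0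
  have hβ1W : β 1 ∉ W := by
    rintro (h | h)
    · exact (hβO 1 (right_mem_Icc.2 zero_le_one)).1 (hLO h)
    · exact hE3 _ h hβ1
  have hβ1M : β 1 ∉ M :=
    Quad.not_mem_below_of_path_avoiding hβ1 (Path.refl (β 1)) (by
      rintro _ ⟨t, rfl⟩; exact hβQ (right_mem_Icc.2 zero_le_one)) (fun _ => by simpa using hβ1W)
  -- last visit to `M`: at a point of `W`, hence of `E`
  obtain ⟨s₀, hs₀, hs₀W, hafter⟩ :=
    Quad.exists_final_segment_avoiding_below hWc.isClosed hβc hβQ hβ0M hβ1M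
  have hs₀E : β s₀ ∈ E := by
    rcases hs₀W with h | h
    · exact absurd (hLO h) (hβO s₀ ⟨hs₀.1, hs₀.2.le⟩).1
    · exact h
  have hs₀x : dist (β s₀) x ≤ ρ := hEx _ hs₀E
  -- the final segment, reparametrised: `γ : [0,1] → [Q]`, off the open edges, from `β s₀` to `∂₃Q`
  obtain ⟨hγc, hγ0, hγ1, hγmaps⟩ := exists_reparam hβc hs₀.1 hs₀.2.le le_rfl
  set γ : ℝ → ℂ := fun t => β (s₀ + t * (1 - s₀)) with hγ
  have hγO : ∀ t ∈ Icc (0 : ℝ) 1, γ t ∉ openEdgeUnion δ ω ∧ γ t ∉ range (meshPoint δ) := fun t ht =>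
    hβO _ (let h := hγmaps t ht; ⟨hs₀.1.trans h.1, h.2⟩)
  have hγQ : ∀ t ∈ Icc (0 : ℝ) 1, γ t ∈ Q.carrier := fun t ht =>
    hβQ (let h := hγmaps t ht; ⟨hs₀.1.trans h.1, h.2⟩)
  have hγM : ∀ t ∈ Icc (0 : ℝ) 1, 0 < t → γ t ∉ M := fun t ht ht0 => by
    have h := hγmaps t ht
    refine hafter _ ⟨?_, h.2⟩
    show s₀ < s₀ + t * (1 - s₀)
    nlinarith [hs₀.2]
  -- `γ` reaches distance `≥ c₃ / 2` from `x`
  have hfarpt : ∃ t ∈ Icc (0 : ℝ) 1, c₃ / 2 ≤ dist (γ t) x := by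
    by_contra hcon
    push Not at hcon
    obtain ⟨p₁, hp₁Q, hp₁x⟩ := hEjoin _ hs₀E
    obtain ⟨p₂, hp₂⟩ := exists_path_of_continuousOn hγc
    have hp₂r : range p₂ ⊆ γ '' Icc 0 1 := by
      rintro _ ⟨t, rfl⟩; exact ⟨t, t.2, (hp₂ t).symm⟩
    have e0 : γ 0 = β s₀ := hγ0
    have e1 : γ 1 = β 1 := hγ1
    let p : Path x (β 1) := p₁.trans (p₂.cast e0.symm e1.symm)
    have hprange : range p ⊆ range p₁ ∪ γ '' Icc 0 1 := by
      rw [Path.trans_range]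
      refine union_subset_union le_rfl ?_
      intro z hz
      rw [Path.cast_coe] at hz
      exact hp₂r hz
    have hpQ : range p ⊆ Q.carrier := hprange.trans (union_subset hp₁Q (by
      rintro _ ⟨t, ht, rfl⟩; exact hγQ t ht))
    have hdiam := hfar (β 1) hβ1 p hpQ
    have hK : IsCompact (range p₁ ∪ γ '' Icc 0 1) :=
      (isCompact_range p₁.continuous).union (isCompact_Icc.image_of_continuousOn hγc)
    obtain ⟨m, hm, hmax⟩ := hK.exists_isMaxOn ⟨x, Or.inl ⟨0, p₁.source⟩⟩
      (continuous_id.dist continuous_const).continuousOn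
    have hmlt : dist m x < c₃ / 2 := by
      rcases hm with ⟨s', rfl⟩ | ⟨t, ht, rfl⟩
      · exact (hp₁x s').trans_lt hρc₃
      · exact hcon t ht
    have hbound : Metric.diam (range p) ≤ 2 * dist m x := by
      refine Metric.diam_le_of_forall_dist_le (by positivity) fun u hu v hv => ?_
      have hu' : dist u x ≤ dist m x := hmax (hprange hu)
      have hv' : dist v x ≤ dist m x := hmax (hprange hv)
      linarith [dist_triangle u x v, dist_comm x v]
    linarith
  obtain ⟨t₁, ht₁, ht₁far⟩ := hfarpt
  have ht₁0 : 0 < t₁ := by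
    rcases ht₁.1.eq_or_lt with h | h
    · exfalso; rw [← h, hγ0] at ht₁far; linarith
    · exact h
  -- restrict `γ` to `[0, t₁]`
  obtain ⟨hγ'c, hγ'0, hγ'1, hγ'maps⟩ := exists_reparam hγc le_rfl ht₁.1 ht₁.2
  set γ' : ℝ → ℂ := fun t => γ (0 + t * (t₁ - 0)) with hγ'
  -- the last visit to `B̄(x, r₀)`
  obtain ⟨u₀, hu₀, hu₀eq, hu₀after⟩ := exists_last_le (g := fun t => dist (γ' t) x)
    ((continuous_id.dist continuous_const).comp_continuousOn hγ'c) (show dist (γ' 0) x < r₀ by rw [hγ'0, hγ0]; linarith)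
    (show r₀ < dist (γ' 1) x by rw [hγ'1]; linarith)
  -- restrict to `[u₀, 1]`, then up to the first exit from `B(x, c₃/2)`
  obtain ⟨hγ₂c, hγ₂0, hγ₂1, hγ₂maps⟩ := exists_reparam hγ'c hu₀.1.le hu₀.2.le le_rfl
  set γ₂ : ℝ → ℂ := fun t => γ' (u₀ + t * (1 - u₀)) with hγ₂
  have h0 : dist (γ₂ 0) x < c₃ / 2 := by rw [hγ₂0]; exact hu₀eq.trans_lt hr₀c₃
  have h1 : c₃ / 2 ≤ dist (γ₂ 1) x := by rw [hγ₂1, hγ'1]; exact ht₁far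
  obtain ⟨γ₃, hγ₃c, hγ₃0, hγ₃mem, hγ₃R, hγ₃1⟩ := exists_restrict_until_dist_ge hγ₂c h0 h1
  -- every point of `γ₃` is a point `γ t` with `t > 0` at distance `≥ r₀` from `x`
  have hγ₃pts : ∀ t ∈ Icc (0 : ℝ) 1, ∃ s ∈ Icc (0 : ℝ) 1, 0 < s ∧ γ₃ t = γ s ∧ r₀ ≤ dist (γ s) x := by
    intro t ht
    obtain ⟨u, hu, hu'⟩ := hγ₃mem t ht
    obtain ⟨hv1, hv2⟩ := hγ₂maps u hu
    set v : ℝ := u₀ + u * (1 - u₀) with hv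
    have hvI : v ∈ Icc (0 : ℝ) 1 := ⟨hu₀.1.le.trans hv1, hv2⟩
    obtain ⟨hw1, hw2⟩ := hγ'maps v hvI
    refine ⟨0 + v * (t₁ - 0), ⟨hw1, hw2.trans ht₁.2⟩, ?_, ?_, ?_⟩
    · have : 0 < v := hu₀.1.trans_le hv1
      nlinarith
    · rw [← hu']
    · show r₀ ≤ dist (γ' v) x
      rcases hv1.eq_or_lt with h | h
      · rw [← h, hu₀eq]
      · exact (hu₀after v hvI h).le
  have hγ₃O : ∀ t ∈ Icc (0 : ℝ) 1, γ₃ t ∉ openEdgeUnion δ ω := fun t ht => by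
    obtain ⟨s, hs, -, hse, -⟩ := hγ₃pts t ht
    rw [hse]; exact (hγO s hs).1
  have hγ₃S : ∀ t ∈ Icc (0 : ℝ) 1, ∀ a b : Site 2, (zdGraph 2).Adj a b → s(a, b) ∈ S →
      γ₃ t ∉ segment ℝ (meshPoint δ a) (meshPoint δ b) := by
    intro t ht a b hab hS' hseg
    obtain ⟨s, hs, hs0, hse, hsfar⟩ := hγ₃pts t ht
    rw [hse] at hseg
    by_cases hω : s(a, b) ∈ ω
    · exact (hγO s hs).1 (mem_openEdgeUnion_iff.2 ⟨a, b, hab, hω, hseg⟩)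
    rcases hS a b hab hS' hω (γ s) hseg (hγQ s hs) (hγM s hs hs0) with hV | hd
    · exact (hγO s hs).2 hV
    · linarith
  have h0' : dist (γ₃ 0) x ≤ r₀ := by rw [hγ₃0, hγ₂0, hu₀eq]
  exact mem_annulusDualCrossingOff_of_path hδ x hγ₃c hγ₃O hγ₃S h0' hγ₃R hγ₃1 hr₀c

end Quad

end QuadCrossing

end Literature.Probability.Percolation
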